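import Summits.QuantumFields.GaugeBoot.Rows.SymFam
import Summits.QuantumFields.GaugeBoot.Rows.SymLoop
import Summits.QuantumFields.GaugeBoot.Rows.RedEncSparse
import HarnessLib

/-!
# Gauge-boot: symmetry kit `SymAsm` — kernel-check interfaces and the generic block assembly

Cell `pub-gaugeboot` (HOME `run/shared/lean/pub/pub-gaugeboot/`), seat lean1 (torus layer for the kz-L2-rp-4D family; reusable for
every `D = 4` family).  HONEST FRAMING (page 1 of every file of this cell): certified bounds on lattice expectations at STATED coupling,
gauge group, dimension and torus size; NOT a mass gap, NOT a continuum limit, NOT a string tension, NOT large `N`.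
The venture is explicitly NOT Yang–Mills-summit-bearing (barriers `FixedCouplingUltralocality`, `PerturbativeInvisibility`).

Turns the per-family KERNEL CHECKS (all `decide +kernel` over ranges, emitted by the seat generator `famgen5.py`) into the hypotheses of
`SymB4.symBlock_posSemidef` and into the entry identity with lean3's reduced blocks:
* `eval_eq_of_entryCheck`: soundness of `SymB4.entryCheck` (`SymLoop`): the relabelling by rank is injective on every occurring variable
  (each hit is verified), so `RedEnc.eval_eq_of_encCheck` on the slots transfers back to the original variables;
* `entries_eq'`: the checks for `i ≤ j` + symmetry of both sides give lean3's entries `evalComb (ent i j) y = (den/(s_i s_j))·Σ_t c_t·…`;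
* `block_posSemidef'`: THE GENERIC BLOCK THEOREM — Gram functional hypotheses + irrep data + closed representative words + link
  `y (cls i (1024 j + t)) = G(x_i, t·x_j)` + entry checks ⇒ lean3's block `(evalComb (ent i j) y)_{ij}` is positive semidefinite;
* `W_raw{H,S,L}w_transport`: transport of row-table entries along the symmetry (for the pair-orbit certification).  [folklore]
-/

noncomputable section

open Literature.MathematicalPhysics.QuantumFieldTheory
open Finset Matrix
open Summit.QuantumFields.GaugeBoot.GLYZc2D3 (SVec)

namespace Summit.QuantumFields.GaugeBoot

namespace SymB4

/-- An assignment extended by `0` beyond `NV`. -/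
def yN {NV : ℕ} (y : Fin NV → ℝ) (v : ℕ) : ℝ := if h : v < NV then y ⟨v, h⟩ else 0

/-- `yN` at an index `< NV`. -/
theorem yN_of_lt {NV : ℕ} (y : Fin NV → ℝ) {v : ℕ} (h : v < NV) : yN y v = y ⟨v, h⟩ := by simp [yN, h]

/-- lean3's entry evaluation is the sparse-form evaluation at `yN y`. -/
theorem evalComb_eq_eval {NV : ℕ} (y : Fin NV → ℝ) : ∀ l : SVec, Certificates.Sparse.evalComb l y = GLYZc2D3.SVec.eval (yN y) l
  | [] => by simp [GLYZc2D3.SVec.eval]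
  | (w, c) :: t => by
    rw [Certificates.Sparse.evalComb_cons, GLYZc2D3.SVec.eval_cons, evalComb_eq_eval y t]
    simp only [yN]
    split_ifs <;> simp

/-- Scaling the coefficients scales the value. -/
theorem eval_map_scale (g : ℕ → ℝ) (z : ℤ) : ∀ l : SVec, GLYZc2D3.SVec.eval g (l.map fun p => (p.1, z * p.2)) = (z : ℝ) * GLYZc2D3.SVec.eval g l
  | [] => by simp
  | p :: t => by
    rw [List.map_cons, GLYZc2D3.SVec.eval_cons, GLYZc2D3.SVec.eval_cons, eval_map_scale g z t]
    push_cast; ring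

/-! ## Soundness of the compact entry check -/

/-- Relabelled evaluation: if every key of `l` is hit by its slot, `eval (g ∘ keyAt) (relabel l) = eval g l`. -/
theorem eval_relabel (g : ℕ → ℝ) (kp K : ℕ) :
    ∀ l : SVec, (l.all fun p => keyAt kp (slot kp K p.1) == p.1) = true →
      GLYZc2D3.SVec.eval (fun p => g (keyAt kp p)) (l.map fun p => (slot kp K p.1, p.2)) = GLYZc2D3.SVec.eval g l
  | [], _ => by simp
  | p :: t, h => by
    simp only [List.all_cons, Bool.and_eq_true, beq_iff_eq] at h
    rw [List.map_cons, GLYZc2D3.SVec.eval_cons, GLYZc2D3.SVec.eval_cons, eval_relabel g kp K t h.2]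
    simp [h.1]

/-- Relabelled right factor: if every class of `cj` is hit by its slot, the weighted sum through `keyAt ∘ slot ∘ cls` is the
weighted sum through `cls`. -/
theorem sum_relabel (g : ℕ → ℝ) (kp K : ℕ) (cls : ℕ → ℕ) :
    ∀ cj : SVec, (cj.all fun q => keyAt kp (slot kp K (cls q.1)) == cls q.1) = true →
      (cj.map fun q => (q.2 : ℝ) * g (keyAt kp (slot kp K (cls q.1)))).sum = (cj.map fun q => (q.2 : ℝ) * g (cls q.1)).sum
  | [], _ => by simp
  | q :: t, h => by
    simp only [List.all_cons, Bool.and_eq_true, beq_iff_eq] at h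
    rw [List.map_cons, List.map_cons, List.sum_cons, List.sum_cons, sum_relabel g kp K cls t h.2, h.1]

/-- **Soundness of the compact entry check**: `eval g e = den · Σ_{q ∈ cj} q.2 · g (cls q.1)` for every valuation `g`. -/
theorem eval_eq_of_entryCheck {sb : ℕ} {den : ℤ} {cj : SVec} {cls : ℕ → ℕ} {e : SVec} {extra : List ℕ}
    (h : entryCheck sb den cj cls e extra = true) (g : ℕ → ℝ) :
    GLYZc2D3.SVec.eval g e = (den : ℝ) * (cj.map fun q => (q.2 : ℝ) * g (cls q.1)).sum := by
  unfold entryCheck at h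
  simp only [Bool.and_eq_true, decide_eq_true_eq] at h
  obtain ⟨⟨⟨hK, he⟩, hc⟩, hchk⟩ := h
  set ks := keysOf e extra
  set K := ks.length
  set kp := kpack ks
  have hlt : ∀ a b : ℕ, (fun (_ : ℕ) (q : ℕ) => slot kp K (cls q)) a b < K := fun _ q => slot_lt hK _
  have hR := RedEnc.eval_eq_of_encCheck hlt hchk (fun p => g (keyAt kp p))
  rw [eval_relabel g kp K e he, eval_expand_singleton, sum_relabel g kp K cls cj hc] at hR
  exact hR

/-! ## Block assembly with the compact check -/

section Asm

variable {NV m nT sb : ℕ} (y : Fin NV → ℝ) (entf : ℕ → ℕ → SVec) (cls : ℕ → ℕ → ℕ)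
  (c : ℕ → ℤ) (tcode : ℕ → ℕ) (den : ℕ) (s : Fin m → ℤ) (extra : ℕ → ℕ → List ℕ)

/-- Entries of lean3's block are the factorised sums (compact-check version of `entries_eq`). -/
theorem entries_eq' (B : Fin m → Fin m → ℝ) (hent : ∀ i j, entf i j = entf j i) (hs : ∀ i, s i ≠ 0)
    (hB : ∀ i j : Fin m, B i j = (den : ℝ) / (s i * s j) * ∑ t : Fin nT, (c (tcode t.val) : ℝ) * yN y (cls i.val (1024 * j.val + t.val)))
    (hBsymm : ∀ i j, B i j = B j i)
    (hchk : ∀ i j : Fin m, i.val ≤ j.val →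
      entryCheck sb (den : ℤ) (cjOf c tcode nT j.val) (cls i.val) ((entf i.val j.val).map fun p => (p.1, s i * s j * p.2)) (extra i.val j.val) = true) :
    ∀ i j : Fin m, Certificates.Sparse.evalComb (entf i.val j.val) y = B i j := by
  have hle : ∀ i j : Fin m, i.val ≤ j.val → Certificates.Sparse.evalComb (entf i.val j.val) y = B i j := by
    intro i j hij
    have hsi : (s i : ℝ) ≠ 0 := by exact_mod_cast hs i
    have hsj : (s j : ℝ) ≠ 0 := by exact_mod_cast hs j
    have h := eval_eq_of_entryCheck (hchk i j hij) (yN y)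
    rw [eval_map_scale, sum_cjOf] at h
    rw [hB i j, evalComb_eq_eval]
    have h' : GLYZc2D3.SVec.eval (yN y) (entf i.val j.val) =
        ((den : ℤ) : ℝ) * (∑ t : Fin nT, (c (tcode t.val) : ℝ) * yN y (cls i.val (1024 * j.val + t.val))) / ((s i : ℝ) * (s j : ℝ)) := by
      rw [eq_div_iff (mul_ne_zero hsi hsj), ← h]; push_cast; ring
    rw [h']; push_cast; ring
  intro i j
  rcases le_total i.val j.val with hij | hji
  · exact hle i j hij
  · rw [hent, hBsymm]; exact hle j i hji

/-- **Generic block theorem** (compact-check version of `block_posSemidef`). -/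
theorem block_posSemidef' {ok : Word 4 → Prop} {stab : ℕ → Prop} (G : Word 4 → Word 4 → ℝ)
    (hGs : GSymm G) (hGi : GInv G stab) (hstabinv : ∀ u : Fin 768, stab u.val → stab (inv u.val)) (hGp : GPsd G ok)
    (tc : Fin nT → Fin 768) (htc : ∀ t : Fin nT, (tc t).val = tcode t.val)
    (x : Fin m → Word 4) (htinj : Function.Injective tc) (hstab : ∀ t, stab (tc t).val)
    (hcT : ∀ u : Fin 768, c u.val ≠ 0 → ∃ t, tc t = u) (hden : 0 < den)
    (hC1 : ∀ w : Fin 768, ∑ t, c (tc t).val * c (mul (tc t).val w.val) = den * c w.val)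
    (hx : ∀ i, Word.disp (x i) = 0) (hok : ∀ t i, ok (gactT (tc t).val (x i))) (hs : ∀ i, s i ≠ 0)
    (hent : ∀ i j, entf i j = entf j i)
    (hlink : ∀ i j : Fin m, ∀ t : Fin nT, yN y (cls i.val (1024 * j.val + t.val)) = G (x i) (gactT (tc t).val (x j)))
    (hchk : ∀ i j : Fin m, i.val ≤ j.val →
      entryCheck sb (den : ℤ) (cjOf c tcode nT j.val) (cls i.val) ((entf i.val j.val).map fun p => (p.1, s i * s j * p.2)) (extra i.val j.val) = true) :
    (Matrix.of fun i j : Fin m => Certificates.Sparse.evalComb (entf i.val j.val) y).PosSemidef := by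
  set Bm : Fin m → Fin m → ℝ := fun i j => (den : ℝ) / (s i * s j) * ∑ t, (c (tc t).val : ℝ) * G (x i) (gactT (tc t).val (x j)) with hBm
  have hB : ∀ i j : Fin m, Bm i j = (den : ℝ) / (s i * s j) * ∑ t : Fin nT, (c (tcode t.val) : ℝ) * yN y (cls i.val (1024 * j.val + t.val)) := by
    intro i j
    simp only [hBm]
    congr 1
    exact Finset.sum_congr rfl fun t _ => by rw [hlink i j t, htc t]
  have hBsymm : ∀ i j, Bm i j = Bm j i := fun i j =>
    symBlock_symm tc c den x s hGs hGi hstabinv htinj hstab hcT hden hC1 hx i j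
  have hE := entries_eq' y entf cls c tcode den s extra Bm hent hs hB hBsymm hchk
  have hM : (Matrix.of fun i j : Fin m => Certificates.Sparse.evalComb (entf i.val j.val) y) = Matrix.of fun i j => Bm i j := by
    ext i j; exact hE i j
  rw [hM]
  exact symBlock_posSemidef tc c hGs hGi hstabinv hGp htinj hstab hcT den hden hC1 x hx hok s hs

end Asm

/-! ## Transport of row-table entries along the symmetry -/

section Transport

variable (β : ℝ) (L : ℕ) [NeZero L]

/-- **Transport**: if `u·a₀ = a` and `u·b₀ = b` then `⟨W_0(a⁻¹b)⟩ = ⟨W_0(a₀⁻¹b₀)⟩`; with the swap flag the pair is transposed first. -/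
theorem W_rawHw_transport (u : Fin 768) {a0 b0 a b : Word 4} (ha0 : Word.disp a0 = 0) (hb0 : Word.disp b0 = 0) (sw : Bool)
    (h : if sw then gactT u.val b0 = a ∧ gactT u.val a0 = b else gactT u.val a0 = a ∧ gactT u.val b0 = b) :
    Rung0D4.W β L (rawHw a b) = Rung0D4.W β L (rawHw a0 b0) := by
  cases sw
  · simp only [Bool.false_eq_true, ↓reduceIte] at h
    rw [← h.1, ← h.2]; exact W_rawHw_gactT β L u a0 b0 ha0 hb0
  · simp only [↓reduceIte] at h
    rw [← h.1, ← h.2, W_rawHw_gactT β L u b0 a0 hb0 ha0]; exact GSymm_H β L b0 a0 hb0 ha0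

/-- Site version (time-axis-fixing `u`). -/
theorem W_rawSw_transport (u : Fin 768) (hu : Fix0 u.val) {a0 b0 a b : Word 4} (ha0 : Word.disp a0 = 0) (hb0 : Word.disp b0 = 0)
    (sw : Bool) (h : if sw then gactT u.val b0 = a ∧ gactT u.val a0 = b else gactT u.val a0 = a ∧ gactT u.val b0 = b) :
    Rung0D4.W β L (rawSw a b) = Rung0D4.W β L (rawSw a0 b0) := by
  cases sw
  · simp only [Bool.false_eq_true, ↓reduceIte] at h
    rw [← h.1, ← h.2]; exact W_rawSw_gactT β L u hu a0 b0 ha0 hb0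
  · simp only [↓reduceIte] at h
    rw [← h.1, ← h.2, W_rawSw_gactT β L u hu b0 a0 hb0 ha0]; exact GSymm_S β L b0 a0 hb0 ha0

/-- Link version (time-axis-fixing `u`). -/
theorem W_rawLw_transport (u : Fin 768) (hu : Fix0 u.val) {a0 b0 a b : Word 4} (ha0 : Word.disp a0 = 0) (hb0 : Word.disp b0 = 0)
    (sw : Bool) (h : if sw then gactT u.val b0 = a ∧ gactT u.val a0 = b else gactT u.val a0 = a ∧ gactT u.val b0 = b) :
    Rung0D4.W β L (rawLw a b) = Rung0D4.W β L (rawLw a0 b0) := by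
  cases sw
  · simp only [Bool.false_eq_true, ↓reduceIte] at h
    rw [← h.1, ← h.2]; exact W_rawLw_gactT β L u hu a0 b0 ha0 hb0
  · simp only [↓reduceIte] at h
    rw [← h.1, ← h.2, W_rawLw_gactT β L u hu b0 a0 hb0 ha0]; exact GSymm_L β L b0 a0 hb0 ha0

end Transport

end SymB4

end Summit.QuantumFields.GaugeBoot

end
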